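import Literature.Geometry.Kaehler.ComplexTorusAutomorphismOrderRealisation
import HarnessLib

/-!
# The strong Goldbach conjecture ⟺ every dimension `g ≥ 3` has an automorphism order `pq` new to it
# (Bamberg–Cairns–Kilminster 2003, Theorem 3, read on complex abelian varieties)

Layer `Literature/Geometry/Kaehler`, namespace `Literature.Geometry.Kaehler.ComplexTorus`; lane
`lit-hodgefound` (Track 2 foundations), self-proposed rider of seat `lit-hodgefound-p38` (generation 6) to its
rows Q625 (`ComplexTorusAutomorphismOrderRealisation.lean`: the orders of group automorphisms of `g`-dimensional
complex abelian varieties are exactly `{m | ψ(m) ≤ 2g} = Ord_{2g}`) and Q531 + appends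
(`Literature/LinearAlgebra/Matrix/CrystallographicRestrictionConverse.lean`: Theorem 1 and THEOREM 3 (1) ⟺ (2)
of [BCK] for integer matrices, `strongGoldbach_iff_forall_exists_matrix_orderOf_mul`).

Source, held `paper:doi-10-2307-3647934` (J. Bamberg, G. Cairns, D. Kilminster, *The crystallographic
restriction, permutations, and Goldbach's conjecture*, Amer. Math. Monthly 110 (2003)), p0007 L59–p0008 L10,
verbatim: "**Strong Goldbach Conjecture.** Every even natural number `x` greater than six can be written as the
sum of two distinct odd primes. … **Theorem 3.** The following statements are equivalent: 1. the strong
Goldbach conjecture is true; 2. for each even `n ≥ 6` there is an `n × n` integer matrix of order `pq` for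
distinct odd primes `p` and `q`, and there is no smaller integer matrix of this order; … Proof. To prove that
(1) and (2) are equivalent, it suffices to note that for `n ≥ 6` one has `n + 2 = p + q` for distinct odd
primes `p` and `q` if and only if `n = (p − 1) + (q − 1) = ψ(pq)`."

Since `ψ(m) ≤ 2 dim X` for every group endomorphism of finite order `m` of a complex torus `X` (Q440) and every
`m` with `ψ(m) ≤ 2g` IS the order of a group automorphism of a `g`-dimensional abelian variety (Q625), statement
(2) at `n = 2g` reads on abelian varieties, and THEOREM 3 becomes (this file, theorems only, NO named fact —
the conjecture is one side of an `↔`, never asserted):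

* `exists_abelianVariety_automorphism_and_forall_lt_iff_crPsi_eq` — for `m ≥ 1`, `g ≥ 2`: "some
  `g`-dimensional complex abelian variety has a group automorphism `ρ(A)` of order exactly `m`, and no complex torus
  of dimension `< g` has a group endomorphism of order exactly `m`" `⟺ ψ(m) = 2g` (`ψ` is even; `g ≥ 2` because of
  the exception `ψ(2) = 0`);
* **`strongGoldbach_iff_forall_exists_abelianVariety_automorphism`** — THE STRONG GOLDBACH CONJECTURE HOLDS IFF
  for every `g ≥ 3` there are distinct odd primes `p`, `q` such that some `g`-dimensional complex abelian variety
  has a group automorphism of order `pq` while no complex torus of smaller dimension has a group endomorphism of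
  order exactly `pq`.

## References

* [BambergCairnsKilminster2003] J. Bamberg, G. Cairns, D. Kilminster, *The crystallographic restriction,
  permutations, and Goldbach's conjecture*, Amer. Math. Monthly 110 (2003) 202–209, Thm. 3.
* [Lange2023AbelianVarietiesComplex] H. Lange, *Abelian Varieties over the Complex Numbers* (2023), §2.4.5
  Exercise (10).
-/

noncomputable section

open scoped Classical Manifold ContDiff
open Module Function Matrix

namespace Literature.Geometry.Kaehler.ComplexTorus

open Literature.LinearAlgebra.Matrix

/-- **`Ord_{2g} ∖ Ord_{2g−2} = ψ⁻¹{2g}` on abelian varieties**: for `m ≥ 1` and `g ≥ 2`, some `g`-dimensional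
complex abelian variety has a group automorphism `ρ(A)` of order exactly `m` and NO complex torus of dimension
`< g` has a group endomorphism `ρ(A)` of order exactly `m`, iff `ψ(m) = 2g` (`ψ` is even, so "`2g − 1 ≤ ψ(m) ≤ 2g`"
is `ψ(m) = 2g`; `g ≥ 2` because of the exception `ψ(2) = 0`: the order `2` is new in dimension `1`).
[cite: BambergCairnsKilminster2003, Thm. 1, p. 2 (`Ord_n ∖ Ord_{n−1} = ψ⁻¹{n}`, `ψ` even)]
[cite: Lange2023AbelianVarietiesComplex, §2.4.5 Exercise (10)] -/
theorem exists_abelianVariety_automorphism_and_forall_lt_iff_crPsi_eq {m g : ℕ} (hm : 0 < m) (hg : 2 ≤ g) :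
    ((∃ (ι : Type) (_ : Fintype ι) (E : Type) (_ : NormedAddCommGroup E) (_ : NormedSpace ℂ E)
        (Φ : (ι → ℝ) ≃L[ℝ] E) (A : Matrix ι ι ℤ),
        IsAbelianVariety Φ ∧ finrank ℂ E = g ∧
          (mapMatrix Φ Φ A)^[m] = id ∧ ∀ k, 0 < k → k < m → (mapMatrix Φ Φ A)^[k] ≠ id) ∧
      ∀ (ι : Type) [Fintype ι] (E : Type) [NormedAddCommGroup E] [NormedSpace ℂ E] [FiniteDimensional ℂ E]
        (Φ : (ι → ℝ) ≃L[ℝ] E) (A : Matrix ι ι ℤ), finrank ℂ E < g →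
        ¬((mapMatrix Φ Φ A)^[m] = id ∧ ∀ k, 0 < k → k < m → (mapMatrix Φ Φ A)^[k] ≠ id)) ↔
      crPsi m = 2 * g := by
  constructor
  · rintro ⟨hex, hnot⟩
    have hle : crPsi m ≤ 2 * g := (exists_abelianVariety_automorphism_iff_crPsi_le hm (by omega)).1 hex
    obtain ⟨j, hj⟩ := even_crPsi m
    by_contra hne
    -- then `ψ(m) ≤ 2(g − 1)` and `m` is already realised in dimension `g − 1 ≥ 1`
    obtain ⟨ι, _, E, _, _, Φ, A, -, hE, -, -, -, hper, hmin⟩ :=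
      exists_abelianVariety_automorphism_of_crPsi_le (g := g - 1) hm (by omega) (by omega)
    haveI : FiniteDimensional ℂ E := Module.finite_of_finrank_pos (by rw [hE]; omega)
    exact hnot ι E Φ A (by rw [hE]; omega) ⟨hper, hmin⟩
  · intro hψ
    refine ⟨(exists_abelianVariety_automorphism_iff_crPsi_le hm (by omega)).2 hψ.le, ?_⟩
    intro ι _ E _ _ _ Φ A hdim ⟨hper, hmin⟩
    have h := crPsi_le_two_mul_finrank_of_iterate_mapMatrix_eq_id Φ hm hper hmin
    omega

/-- **Theorem 3 of Bamberg–Cairns–Kilminster on complex abelian varieties: the STRONG GOLDBACH CONJECTURE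
("every even natural number `x` greater than six can be written as the sum of two distinct odd primes") holds
if and only if for every `g ≥ 3` there are distinct odd primes `p`, `q` such that some `g`-dimensional complex
abelian variety has a group automorphism `ρ(A)` of order `pq`, while no complex torus of dimension `< g` has a
group endomorphism of order exactly `pq`** (statement (2) of Theorem 3 at `n = 2g`, transported by Theorem 1 on
tori / abelian varieties; both sides are stated propositions, neither is asserted).
[cite: BambergCairnsKilminster2003, Thm. 3 (1) ⟺ (2) and its proof (pp. 7–8)]
[cite: Lange2023AbelianVarietiesComplex, §2.4.5 Exercise (10)] -/
theorem strongGoldbach_iff_forall_exists_abelianVariety_automorphism :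
    (∀ x : ℕ, Even x → 6 < x → ∃ p q : ℕ, p.Prime ∧ q.Prime ∧ p ≠ q ∧ p ≠ 2 ∧ q ≠ 2 ∧ x = p + q) ↔
      ∀ g : ℕ, 3 ≤ g → ∃ p q : ℕ, p.Prime ∧ q.Prime ∧ p ≠ q ∧ p ≠ 2 ∧ q ≠ 2 ∧
        (∃ (ι : Type) (_ : Fintype ι) (E : Type) (_ : NormedAddCommGroup E) (_ : NormedSpace ℂ E)
          (Φ : (ι → ℝ) ≃L[ℝ] E) (A : Matrix ι ι ℤ),
          IsAbelianVariety Φ ∧ finrank ℂ E = g ∧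
            (mapMatrix Φ Φ A)^[p * q] = id ∧ ∀ k, 0 < k → k < p * q → (mapMatrix Φ Φ A)^[k] ≠ id) ∧
        ∀ (ι : Type) [Fintype ι] (E : Type) [NormedAddCommGroup E] [NormedSpace ℂ E] [FiniteDimensional ℂ E]
          (Φ : (ι → ℝ) ≃L[ℝ] E) (A : Matrix ι ι ℤ), finrank ℂ E < g →
          ¬((mapMatrix Φ Φ A)^[p * q] = id ∧ ∀ k, 0 < k → k < p * q → (mapMatrix Φ Φ A)^[k] ≠ id) := by
  constructor
  · intro h g hg
    obtain ⟨p, q, hp, hq, hpq, hp2, hq2, hx⟩ := h (2 * g + 2) ⟨g + 1, by omega⟩ (by omega)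
    refine ⟨p, q, hp, hq, hpq, hp2, hq2, ?_⟩
    have hψ : crPsi (p * q) = 2 * g := (crPsi_mul_eq_iff_add_two_eq_add hp hq hpq hp2 hq2).2 hx
    exact (exists_abelianVariety_automorphism_and_forall_lt_iff_crPsi_eq (Nat.mul_pos hp.pos hq.pos)
      (by omega)).2 hψ
  · intro h x hx h6
    obtain ⟨y, hy⟩ := hx
    obtain ⟨p, q, hp, hq, hpq, hp2, hq2, hreal⟩ := h (y - 1) (by omega)
    refine ⟨p, q, hp, hq, hpq, hp2, hq2, ?_⟩
    have hψ := (exists_abelianVariety_automorphism_and_forall_lt_iff_crPsi_eq (Nat.mul_pos hp.pos hq.pos)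
      (by omega)).1 hreal
    have h2 := (crPsi_mul_eq_iff_add_two_eq_add hp hq hpq hp2 hq2).1 hψ
    omega

end Literature.Geometry.Kaehler.ComplexTorus

end
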